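import Summits.HodgeConjecture.HodgeConjecture.Theorems.Ring2WeilCoverageNormClassEq
import Summits.HodgeConjecture.HodgeConjecture.Theorems.Ring2WeilCoverageNormTableC
import HarnessLib

/-!
# Weil-type family coverage — product windows, part M: THE FIBRE-PRODUCT / PILLOWCASE WINDOW over `ℚ(i)`, and the first `S₂₂` / `A₂₁` data

research route conditional on HC_CM; not a corollary; Q11.4-sentence-2 already refuted in dim ≥ 3.

Ring 2, WEIL-TYPE FAMILY-COVERAGE CENSUS (`HOME/WEIL-FAMILY-COVERAGE.md` `## b04`, block b04.15, owner ring2-b04, gen 51); thirteenth part of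
`Ring2WeilCoverageProductWindow` (companion of part L, same conventions and engines; mirror `HOME/pub-hodge-ring2-b04/census-g51/`).
LITERAL CLASSES with CELL IDENTIFICATION for:
* §1 THE PILLOWCASE WINDOW over `ℚ(i)` (THEOREM S10 for `k = 4`): the double of a wall 9-gon `P` of the `B₂` alcove lattice (sides along
  the walls of the `(4,4,2)` tiling, corners at its vertices; corner counts `(n₁,n₂,n₃) = #{ε = 1,2,3}` in `{(2,7,0),(3,5,1),(4,3,2),(5,1,3)}`,
  `ε` = the branch exponent of the corner) is a Belyi map `φ_P : ℙ¹ → ℙ¹(4,4,2) = E_i/C₄` of degree `n = #alcoves(P)`; `Y_P =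
  E_i ×_{ℙ¹} ℙ¹_{φ_P}` (`y⁴ = φ_P(φ_P − 1)`, genus 8–9) and `B = ` the `λ`-part of the Prym `P(Y_P/E_i)` is a `(3,3)` WEIL-TYPE abelian
  sixfold with `ℤ[i]`-multiplication on `(3, ℚ(i), [n])` (THEOREM S8: `[a_B] = [n]`, `u = 1`); explicit families give EVERY `n ≥ 7`, hence
  EVERY component `(3, ℚ(i), [a])` — below `n = 7 (W6.1.7), 8, 9 (split), 11, 12 (R3 = W6.1.3, twice), 19 (W6.1.19, ring2-b06's
  structural null of b06.20 P.S. 5), 21 (W6.1.21, the last named R3 class), 23, 28, 33`.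
* §2 the FIRST data of the window, realised by random permutations before the polygon construction (engine `symwin.py`): the rigid
  `C₃ × S₂₂` datum `(3⁵.2.1⁵, 5.3⁵.2, 6².3³.1)` (a degree-22 Belyi map `ℙ¹ → ℙ¹`; `Y` of genus 7) and a ONE-PARAMETER FAMILY on `W6.3.22`;
  the rigid `C₄ × A₂₁` datum `(15.3², 4⁴.1⁵, 2¹⁰.1)` on `W6.1.21`; a one-parameter `C₄ × S₁₉` family on `W6.1.19`.

No `def`, no named fact, no `sorry`; nothing here is a statement about Hodge classes; `HC_CM` is used nowhere.
References: [cite: vanGeemen1994HodgeAV, (5.4.1), Lemma 5.2]; [cite: Serre1973, Ch. III §1].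
-/

set_option linter.dupNamespace false

open Literature.AlgebraicGeometry.Motives
open Literature.AlgebraicGeometry.VanGeemen1994
open Summit.HodgeConjecture.HodgeConjecture.Ring2.Hypotheses

namespace Summit.HodgeConjecture.HodgeConjecture.Ring2.WeilCoverage

namespace SqrtNeg1

/-- `23 ∉ Nm(ℚ(√-1)ˣ)`: descent at the inert prime `23` (`-1` is a non-square mod `23`, `23 ∥ 23`); `T(23) = {2, 23}` — the row key of
`W6.1.23`. research route conditional on HC_CM; not a corollary; Q11.4-sentence-2 already refuted in dim ≥ 3. [cite: Serre1973, Ch. III §1] -/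
theorem not_mem_23 : Units.mk0 (23 : ℚ) (by norm_num) ∉ normUnitsSubgroup ℚ (weilField 1) := by
  simpa using natCast_not_mem_normUnitsSubgroup_of_inert (d := 1) (a := 23) (p := 23)
    (by norm_num) (by decide) (by norm_num) (by norm_num) (by norm_num)

end SqrtNeg1

/-! ### §1 THE PILLOWCASE WINDOW over `ℚ(i)`: Pryms `P(Y_P/E_i)_λ` of the curves `y⁴ = φ_P(φ_P − 1)`, `n = 7 … 33` -/
/-- PILLOWCASE datum (B₂ alcove lattice, orbifold `ℙ¹(4,4,2) = E_i/C₄`): the double of the lattice 9-gon `P` with turning sequence `-2,+1,+3,-2,+2,+2,-1,+2,+3` (×45°) and side lengths `1,1,1,1,1,1,1,1,1` is a Belyi map `φ_P : ℙ¹ → ℙ¹` of degree `n = 7` (= number of alcoves of `P`) with passport `(5.1^2, 3.2^2, 3^2.1)` and monodromy group `A7` (certified lower bound 2520); `Y_P : y⁴ = φ_P(φ_P − 1)` (genus 8) is the normalised fibre product `E ×_{ℙ¹} ℙ¹_{φ_P}` (28 sheets over `ℙ¹`; engine `bigwin.py`, exact) and the HIDDEN FACTOR `B` = the `λ`-part of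 the Prym `P(Y_P/E)` — an abelian SIXFOLD with `(3,3)` `ℚ(√-1)`-action, WEIL TYPE — has literal `det H|_B = -2/7`, `a = 2/7`, `T(a) = [2, 7]`: row `W6.1.7` (NON-split); `r₁ = dim_K H¹(D)_λ = 1`, `r_H = 7`. THEOREM S8 (Prym form of the product-window law, census b04.15 (A): `[a_B] = [n]^{r₁}`, no 2-transitivity needed) predicts `T(a_B) = [2, 7]` from `r₁ = 1`, `n = 7` — CONFIRMED.
research route conditional on HC_CM; not a corollary; Q11.4-sentence-2 already refuted in dim ≥ 3. [cite: vanGeemen1994HodgeAV, (5.4.1)] -/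
theorem pillow4_C4A7_n7_5cce7b_mk_detH_ne_split :
    (QuotientGroup.mk (Units.mk0 (((-2 : ℚ) / 7)) (by norm_num)) : weilNormResidueGroup 1) ≠
      splitDiscriminantClass 3 1 := by
  have e : Units.mk0 (((-2 : ℚ) / 7)) (by norm_num) = -(Units.mk0 ((2 : ℚ) / 7) (by norm_num)) := Units.ext (by norm_num)
  rw [Ne, e, mk_neg_eq_splitDiscriminantClass_iff_of_odd (n := 3) (by decide)]
  have h := mul_not_mem_normUnitsSubgroup (mem_normUnitsSubgroup_of_sq_add_mul_sq (d := 1) (a := ((2 : ℚ) / 49)) (by norm_num) ((1 : ℚ) / 7) ((1 : ℚ) / 7) (by norm_num))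
    Summit.HodgeConjecture.Ring2WeilNormDescent.seven_not_mem_norm_one
  rw [mk0_mul_mk0] at h
  norm_num at h
  exact h

/-- The same datum, CELL IDENTIFICATION: `[det H|_B] = [-7]` in `ℚˣ/Nm(ℚ(√-1)ˣ)` — the census ROW KEY of `W6.1.7` (`a·7 = (2 : ℚ) = ((1 : ℚ))² + 1·((1 : ℚ))²`).
research route conditional on HC_CM; not a corollary; Q11.4-sentence-2 already refuted in dim ≥ 3. [cite: vanGeemen1994HodgeAV, Lemma 5.2 (3)] -/
theorem pillow4_C4A7_n7_5cce7b_mk_detH_eq_key :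
    (QuotientGroup.mk (Units.mk0 (-(((2 : ℚ) / 7))) (neg_ne_zero.2 (by norm_num))) : weilNormResidueGroup 1) =
      QuotientGroup.mk (Units.mk0 (-(7 : ℚ)) (neg_ne_zero.2 (by norm_num))) :=
  mk_neg_eq_mk_neg_of_mul_mem (by norm_num) (by norm_num)
    (mem_normUnitsSubgroup_of_sq_add_mul_sq _ (1 : ℚ) (1 : ℚ) (by norm_num))

/-- PILLOWCASE datum (B₂ alcove lattice, orbifold `ℙ¹(4,4,2) = E_i/C₄`): the double of the lattice 9-gon `P` with turning sequence `-2,-1,+3,-2,+3,+1,+1,+2,+3` (×45°) and side lengths `1,1,1,1,1,1,2,1,1` is a Belyi map `φ_P : ℙ¹ → ℙ¹` of degree `n = 8` (= number of alcoves of `P`) with passport `(3^2.1^2, 5.2.1, 3^2.2)` and monodromy group `S8` (certified lower bound 40320); `Y_P : y⁴ = φ_P(φ_P − 1)` (genus 9) is the normalised fibre product `E ×_{ℙ¹} ℙ¹_{φ_P}` (32 sheets over `ℙ¹`; engine `bigwin.py`, exact) and the HIDDEN FACTOR `B` = the `λ`-part of the Prym `P(Y_P/E)` — an abelian SIXFOLD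 with `(3,3)` `ℚ(√-1)`-action, WEIL TYPE — has literal `det H|_B = -1/8`, `a = 1/8`, `T(a) = []`: row `W6.1.1` (SPLIT); `r₁ = dim_K H¹(D)_λ = 1`, `r_H = 7`. THEOREM S8 (Prym form of the product-window law, census b04.15 (A): `[a_B] = [n]^{r₁}`, no 2-transitivity needed) predicts `T(a_B) = []` from `r₁ = 1`, `n = 8` — CONFIRMED.
research route conditional on HC_CM; not a corollary; Q11.4-sentence-2 already refuted in dim ≥ 3. The split class is witnessed constructively: `a = (((1 : ℚ) / 4))² + 1·(((1 : ℚ) / 4))²`. [cite: vanGeemen1994HodgeAV, (5.4.1)] -/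
theorem pillow4_C4S8_n8_8a7830_mk_detH_eq_split :
    (QuotientGroup.mk (Units.mk0 (((-1 : ℚ) / 8)) (by norm_num)) : weilNormResidueGroup 1) =
      splitDiscriminantClass 3 1 := by
  have e : Units.mk0 (((-1 : ℚ) / 8)) (by norm_num) = -(Units.mk0 ((1 : ℚ) / 8) (by norm_num)) := Units.ext (by norm_num)
  rw [e, mk_neg_eq_splitDiscriminantClass_iff_of_odd (n := 3) (by decide)]
  exact mem_normUnitsSubgroup_of_sq_add_mul_sq _ ((1 : ℚ) / 4) ((1 : ℚ) / 4) (by norm_num)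

/-- PILLOWCASE datum (B₂ alcove lattice, orbifold `ℙ¹(4,4,2) = E_i/C₄`): the double of the lattice 9-gon `P` with turning sequence `-2,+1,+3,-2,+2,+2,-1,+2,+3` (×45°) and side lengths `1,1,1,1,2,1,2,1,1` is a Belyi map `φ_P : ℙ¹ → ℙ¹` of degree `n = 9` (= number of alcoves of `P`) with passport `(5.2.1^2, 4.3.2, 3^2.2.1)` and monodromy group `S9` (certified lower bound 362880); `Y_P : y⁴ = φ_P(φ_P − 1)` (genus 8) is the normalised fibre product `E ×_{ℙ¹} ℙ¹_{φ_P}` (36 sheets over `ℙ¹`; engine `bigwin.py`, exact) and the HIDDEN FACTOR `B` = the `λ`-part of the Prym `P(Y_P/E)` — an abelian SIXFOLD with `(3,3)` `ℚ(√-1)`-action, WEIL TYPE — has literal `det H|_B = -2/9`, `a = 2/9`, `T(a) = []`: row `W6.1.1` (SPLIT); `r₁ = dim_K H¹(D)_λ = 1`, `r_H = 7`. THEOREM S8 (Prym form of the product-window law, census b04.15 (A): `[a_B] = [n]^{r₁}`, no 2-transitivity needed) predicts `T(a_B) = []` from `r₁ = 1`, `n = 9` — CONFIRMED.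
research route conditional on HC_CM; not a corollary; Q11.4-sentence-2 already refuted in dim ≥ 3. The split class is witnessed constructively: `a = (((1 : ℚ) / 3))² + 1·(((1 : ℚ) / 3))²`. [cite: vanGeemen1994HodgeAV, (5.4.1)] -/
theorem pillow4_C4S9_n9_d28012_mk_detH_eq_split :
    (QuotientGroup.mk (Units.mk0 (((-2 : ℚ) / 9)) (by norm_num)) : weilNormResidueGroup 1) =
      splitDiscriminantClass 3 1 := by
  have e : Units.mk0 (((-2 : ℚ) / 9)) (by norm_num) = -(Units.mk0 ((2 : ℚ) / 9) (by norm_num)) := Units.ext (by norm_num)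
  rw [e, mk_neg_eq_splitDiscriminantClass_iff_of_odd (n := 3) (by decide)]
  exact mem_normUnitsSubgroup_of_sq_add_mul_sq _ ((1 : ℚ) / 3) ((1 : ℚ) / 3) (by norm_num)

/-- PILLOWCASE datum (B₂ alcove lattice, orbifold `ℙ¹(4,4,2) = E_i/C₄`): the double of the lattice 9-gon `P` with turning sequence `-3,+2,+3,-2,+2,+2,-1,+3,+2` (×45°) and side lengths `2,1,1,1,1,2,2,1,2` is a Belyi map `φ_P : ℙ¹ → ℙ¹` of degree `n = 11` (= number of alcoves of `P`) with passport `(7.2.1^2, 5.2^3, 3.2^4)` and monodromy group `S11` (certified lower bound 39916800); `Y_P : y⁴ = φ_P(φ_P − 1)` (genus 8) is the normalised fibre product `E ×_{ℙ¹} ℙ¹_{φ_P}` (44 sheets over `ℙ¹`; engine `bigwin.py`, exact) and the HIDDEN FACTOR `B` = the `λ`-part of the Prym `P(Y_P/E)` — an abelian SIXFOLD with `(3,3)` `ℚ(√-1)`-action, WEIL TYPE — has literal `det H|_B = -1/22`, `a = 1/22`, `T(a) = [2, 11]`: row `W6.1.11` (NON-split); `r₁ = dim_K H¹(D)_λ =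 1`, `r_H = 7`. THEOREM S8 (Prym form of the product-window law, census b04.15 (A): `[a_B] = [n]^{r₁}`, no 2-transitivity needed) predicts `T(a_B) = [2, 11]` from `r₁ = 1`, `n = 11` — CONFIRMED.
research route conditional on HC_CM; not a corollary; Q11.4-sentence-2 already refuted in dim ≥ 3. [cite: vanGeemen1994HodgeAV, (5.4.1)] -/
theorem pillow4_C4S11_n11_2d685d_mk_detH_ne_split :
    (QuotientGroup.mk (Units.mk0 (((-1 : ℚ) / 22)) (by norm_num)) : weilNormResidueGroup 1) ≠
      splitDiscriminantClass 3 1 := by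
  have e : Units.mk0 (((-1 : ℚ) / 22)) (by norm_num) = -(Units.mk0 ((1 : ℚ) / 22) (by norm_num)) := Units.ext (by norm_num)
  rw [Ne, e, mk_neg_eq_splitDiscriminantClass_iff_of_odd (n := 3) (by decide)]
  have h := mul_not_mem_normUnitsSubgroup (mem_normUnitsSubgroup_of_sq_add_mul_sq (d := 1) (a := ((1 : ℚ) / 242)) (by norm_num) ((1 : ℚ) / 22) ((1 : ℚ) / 22) (by norm_num))
    Summit.HodgeConjecture.HodgeConjecture.Ring2.WeilCoverage.SqrtNeg1.not_mem_11
  rw [mk0_mul_mk0] at h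
  norm_num at h
  exact h

/-- The same datum, CELL IDENTIFICATION: `[det H|_B] = [-11]` in `ℚˣ/Nm(ℚ(√-1)ˣ)` — the census ROW KEY of `W6.1.11` (`a·11 = ((1 : ℚ) / 2) = (((1 : ℚ) / 2))² + 1·(((1 : ℚ) / 2))²`).
research route conditional on HC_CM; not a corollary; Q11.4-sentence-2 already refuted in dim ≥ 3. [cite: vanGeemen1994HodgeAV, Lemma 5.2 (3)] -/
theorem pillow4_C4S11_n11_2d685d_mk_detH_eq_key :
    (QuotientGroup.mk (Units.mk0 (-(((1 : ℚ) / 22))) (neg_ne_zero.2 (by norm_num))) : weilNormResidueGroup 1) =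
      QuotientGroup.mk (Units.mk0 (-(11 : ℚ)) (neg_ne_zero.2 (by norm_num))) :=
  mk_neg_eq_mk_neg_of_mul_mem (by norm_num) (by norm_num)
    (mem_normUnitsSubgroup_of_sq_add_mul_sq _ ((1 : ℚ) / 2) ((1 : ℚ) / 2) (by norm_num))

/-- PILLOWCASE datum (B₂ alcove lattice, orbifold `ℙ¹(4,4,2) = E_i/C₄`): the double of the lattice 9-gon `P` with turning sequence `-3,+2,+2,+3,-2,+2,-2,+3,+3` (×45°) and side lengths `2,1,1,2,1,1,1,1,2` is a Belyi map `φ_P : ℙ¹ → ℙ¹` of degree `n = 12` (= number of alcoves of `P`) with passport `(7.2.1^3, 4^2.2^2, 3^2.2^3)` and monodromy group `S12` (certified lower bound 479001600); `Y_P : y⁴ = φ_P(φ_P − 1)` (genus 8) is the normalised fibre product `E ×_{ℙ¹} ℙ¹_{φ_P}` (48 sheets over `ℙ¹`; engine `bigwin.py`, exact) and the HIDDEN FACTOR `B` = the `λ`-part of the Prym `P(Y_P/E)` — an abelian SIXFOLD with `(3,3)` `ℚ(√-1)`-action, WEIL TYPE — has literal `det H|_B = -1/12`, `a = 1/12`,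 `T(a) = [2, 3]`: row `W6.1.3` (NON-split); `r₁ = dim_K H¹(D)_λ = 1`, `r_H = 7`. THEOREM S8 (Prym form of the product-window law, census b04.15 (A): `[a_B] = [n]^{r₁}`, no 2-transitivity needed) predicts `T(a_B) = [2, 3]` from `r₁ = 1`, `n = 12` — CONFIRMED.
research route conditional on HC_CM; not a corollary; Q11.4-sentence-2 already refuted in dim ≥ 3. [cite: vanGeemen1994HodgeAV, (5.4.1)] -/
theorem pillow4_C4S12_n12_6b355a_mk_detH_ne_split :
    (QuotientGroup.mk (Units.mk0 (((-1 : ℚ) / 12)) (by norm_num)) : weilNormResidueGroup 1) ≠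
      splitDiscriminantClass 3 1 := by
  have e : Units.mk0 (((-1 : ℚ) / 12)) (by norm_num) = -(Units.mk0 ((1 : ℚ) / 12) (by norm_num)) := Units.ext (by norm_num)
  rw [Ne, e, mk_neg_eq_splitDiscriminantClass_iff_of_odd (n := 3) (by decide)]
  have h := mul_not_mem_normUnitsSubgroup (mem_normUnitsSubgroup_of_sq_add_mul_sq (d := 1) (a := ((1 : ℚ) / 36)) (by norm_num) ((1 : ℚ) / 6) (0 : ℚ) (by norm_num))
    Summit.HodgeConjecture.Ring2WeilNormDescent.three_not_mem_norm_one
  rw [mk0_mul_mk0] at h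
  norm_num at h
  exact h

/-- The same datum, CELL IDENTIFICATION: `[det H|_B] = [-3]` in `ℚˣ/Nm(ℚ(√-1)ˣ)` — the census ROW KEY of `W6.1.3` (`a·3 = ((1 : ℚ) / 4) = (((1 : ℚ) / 2))² + 1·((0 : ℚ))²`).
research route conditional on HC_CM; not a corollary; Q11.4-sentence-2 already refuted in dim ≥ 3. [cite: vanGeemen1994HodgeAV, Lemma 5.2 (3)] -/
theorem pillow4_C4S12_n12_6b355a_mk_detH_eq_key :
    (QuotientGroup.mk (Units.mk0 (-(((1 : ℚ) / 12))) (neg_ne_zero.2 (by norm_num))) : weilNormResidueGroup 1) =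
      QuotientGroup.mk (Units.mk0 (-(3 : ℚ)) (neg_ne_zero.2 (by norm_num))) :=
  mk_neg_eq_mk_neg_of_mul_mem (by norm_num) (by norm_num)
    (mem_normUnitsSubgroup_of_sq_add_mul_sq _ ((1 : ℚ) / 2) (0 : ℚ) (by norm_num))

/-- PILLOWCASE datum (B₂ alcove lattice, orbifold `ℙ¹(4,4,2) = E_i/C₄`): the double of the lattice 9-gon `P` with turning sequence `-2,-1,+3,-2,+3,+1,+1,+2,+3` (×45°) and side lengths `1,1,2,1,1,2,2,1,1` is a Belyi map `φ_P : ℙ¹ → ℙ¹` of degree `n = 12` (= number of alcoves of `P`) with passport `(4.3^2.1^2, 5.4.2.1, 3^2.2^3)` and monodromy group `S12` (certified lower bound 479001600); `Y_P : y⁴ = φ_P(φ_P − 1)` (genus 9) is the normalised fibre product `E ×_{ℙ¹} ℙ¹_{φ_P}` (48 sheets over `ℙ¹`; engine `bigwin.py`, exact) and the HIDDEN FACTOR `B` = the `λ`-part of the Prym `P(Y_P/E)` — an abelian SIXFOLD with `(3,3)` `ℚ(√-1)`-action, WEIL TYPE — has literal `det H|_B = -1/24`, `a = 1/24`, `T(a)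 = [2, 3]`: row `W6.1.3` (NON-split); `r₁ = dim_K H¹(D)_λ = 1`, `r_H = 7`. THEOREM S8 (Prym form of the product-window law, census b04.15 (A): `[a_B] = [n]^{r₁}`, no 2-transitivity needed) predicts `T(a_B) = [2, 3]` from `r₁ = 1`, `n = 12` — CONFIRMED.
research route conditional on HC_CM; not a corollary; Q11.4-sentence-2 already refuted in dim ≥ 3. [cite: vanGeemen1994HodgeAV, (5.4.1)] -/
theorem pillow4_C4S12_n12_aa3835_mk_detH_ne_split :
    (QuotientGroup.mk (Units.mk0 (((-1 : ℚ) / 24)) (by norm_num)) : weilNormResidueGroup 1) ≠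
      splitDiscriminantClass 3 1 := by
  have e : Units.mk0 (((-1 : ℚ) / 24)) (by norm_num) = -(Units.mk0 ((1 : ℚ) / 24) (by norm_num)) := Units.ext (by norm_num)
  rw [Ne, e, mk_neg_eq_splitDiscriminantClass_iff_of_odd (n := 3) (by decide)]
  have h := mul_not_mem_normUnitsSubgroup (mem_normUnitsSubgroup_of_sq_add_mul_sq (d := 1) (a := ((1 : ℚ) / 72)) (by norm_num) ((1 : ℚ) / 12) ((1 : ℚ) / 12) (by norm_num))
    Summit.HodgeConjecture.Ring2WeilNormDescent.three_not_mem_norm_one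
  rw [mk0_mul_mk0] at h
  norm_num at h
  exact h

/-- The same datum, CELL IDENTIFICATION: `[det H|_B] = [-3]` in `ℚˣ/Nm(ℚ(√-1)ˣ)` — the census ROW KEY of `W6.1.3` (`a·3 = ((1 : ℚ) / 8) = (((1 : ℚ) / 4))² + 1·(((1 : ℚ) / 4))²`).
research route conditional on HC_CM; not a corollary; Q11.4-sentence-2 already refuted in dim ≥ 3. [cite: vanGeemen1994HodgeAV, Lemma 5.2 (3)] -/
theorem pillow4_C4S12_n12_aa3835_mk_detH_eq_key :
    (QuotientGroup.mk (Units.mk0 (-(((1 : ℚ) / 24))) (neg_ne_zero.2 (by norm_num))) : weilNormResidueGroup 1) =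
      QuotientGroup.mk (Units.mk0 (-(3 : ℚ)) (neg_ne_zero.2 (by norm_num))) :=
  mk_neg_eq_mk_neg_of_mul_mem (by norm_num) (by norm_num)
    (mem_normUnitsSubgroup_of_sq_add_mul_sq _ ((1 : ℚ) / 4) ((1 : ℚ) / 4) (by norm_num))

/-- PILLOWCASE datum (B₂ alcove lattice, orbifold `ℙ¹(4,4,2) = E_i/C₄`): the double of the lattice 9-gon `P` with turning sequence `-3,-1,+3,+2,+1,-2,+3,+2,+3` (×45°) and side lengths `2,1,2,2,2,1,1,2,2` is a Belyi map `φ_P : ℙ¹ → ℙ¹` of degree `n = 19` (= number of alcoves of `P`) with passport `(7.4^2.2.1^2, 5.4^2.3.2.1, 3.2^8)` and monodromy group `S19` (certified lower bound 121645100408832000); `Y_P : y⁴ = φ_P(φ_P − 1)` (genus 9) is the normalised fibre product `E ×_{ℙ¹} ℙ¹_{φ_P}` (76 sheets over `ℙ¹`; engine `bigwin.py`, exact) and the HIDDEN FACTOR `B` = the `λ`-part of the Prym `P(Y_P/E)` — an abelian SIXFOLD with `(3,3)` `ℚ(√-1)`-action, WEIL TYPE — has literal `det H|_B = -1/38`,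 `a = 1/38`, `T(a) = [2, 19]`: row `W6.1.19` (NON-split); `r₁ = dim_K H¹(D)_λ = 1`, `r_H = 7`. THEOREM S8 (Prym form of the product-window law, census b04.15 (A): `[a_B] = [n]^{r₁}`, no 2-transitivity needed) predicts `T(a_B) = [2, 19]` from `r₁ = 1`, `n = 19` — CONFIRMED.
research route conditional on HC_CM; not a corollary; Q11.4-sentence-2 already refuted in dim ≥ 3. [cite: vanGeemen1994HodgeAV, (5.4.1)] -/
theorem pillow4_C4S19_n19_b1fbd7_mk_detH_ne_split :
    (QuotientGroup.mk (Units.mk0 (((-1 : ℚ) / 38)) (by norm_num)) : weilNormResidueGroup 1) ≠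
      splitDiscriminantClass 3 1 := by
  have e : Units.mk0 (((-1 : ℚ) / 38)) (by norm_num) = -(Units.mk0 ((1 : ℚ) / 38) (by norm_num)) := Units.ext (by norm_num)
  rw [Ne, e, mk_neg_eq_splitDiscriminantClass_iff_of_odd (n := 3) (by decide)]
  have h := mul_not_mem_normUnitsSubgroup (mem_normUnitsSubgroup_of_sq_add_mul_sq (d := 1) (a := ((1 : ℚ) / 722)) (by norm_num) ((1 : ℚ) / 38) ((1 : ℚ) / 38) (by norm_num))
    Summit.HodgeConjecture.HodgeConjecture.Ring2.WeilCoverage.SqrtNeg1.not_mem_19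
  rw [mk0_mul_mk0] at h
  norm_num at h
  exact h

/-- The same datum, CELL IDENTIFICATION: `[det H|_B] = [-19]` in `ℚˣ/Nm(ℚ(√-1)ˣ)` — the census ROW KEY of `W6.1.19` (`a·19 = ((1 : ℚ) / 2) = (((1 : ℚ) / 2))² + 1·(((1 : ℚ) / 2))²`).
research route conditional on HC_CM; not a corollary; Q11.4-sentence-2 already refuted in dim ≥ 3. [cite: vanGeemen1994HodgeAV, Lemma 5.2 (3)] -/
theorem pillow4_C4S19_n19_b1fbd7_mk_detH_eq_key :
    (QuotientGroup.mk (Units.mk0 (-(((1 : ℚ) / 38))) (neg_ne_zero.2 (by norm_num))) : weilNormResidueGroup 1) =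
      QuotientGroup.mk (Units.mk0 (-(19 : ℚ)) (neg_ne_zero.2 (by norm_num))) :=
  mk_neg_eq_mk_neg_of_mul_mem (by norm_num) (by norm_num)
    (mem_normUnitsSubgroup_of_sq_add_mul_sq _ ((1 : ℚ) / 2) ((1 : ℚ) / 2) (by norm_num))

/-- PILLOWCASE datum (B₂ alcove lattice, orbifold `ℙ¹(4,4,2) = E_i/C₄`): the double of the lattice 9-gon `P` with turning sequence `-3,-1,+2,+1,+3,-1,+2,+2,+3` (×45°) and side lengths `2,1,1,1,2,2,2,2,2` is a Belyi map `φ_P : ℙ¹ → ℙ¹` of degree `n = 21` (= number of alcoves of `P`) with passport `(7.5.3.2^2.1^2, 5.4^4, 2^10.1)` and monodromy group `A21` (certified lower bound 25545471085854720000); `Y_P : y⁴ = φ_P(φ_P − 1)` (genus 9) is the normalised fibre product `E ×_{ℙ¹} ℙ¹_{φ_P}` (84 sheets over `ℙ¹`; engine `bigwin.py`, exact) and the HIDDEN FACTOR `B` = the `λ`-part of the Prym `P(Y_P/E)` — an abelian SIXFOLD with `(3,3)` `ℚ(√-1)`-action, WEIL TYPE — has literal `det H|_B = -1/21`, `a =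 1/21`, `T(a) = [3, 7]`: row `W6.1.21` (NON-split); `r₁ = dim_K H¹(D)_λ = 1`, `r_H = 7`. THEOREM S8 (Prym form of the product-window law, census b04.15 (A): `[a_B] = [n]^{r₁}`, no 2-transitivity needed) predicts `T(a_B) = [3, 7]` from `r₁ = 1`, `n = 21` — CONFIRMED.
research route conditional on HC_CM; not a corollary; Q11.4-sentence-2 already refuted in dim ≥ 3. [cite: vanGeemen1994HodgeAV, (5.4.1)] -/
theorem pillow4_C4A21_n21_fceac4_mk_detH_ne_split :
    (QuotientGroup.mk (Units.mk0 (((-1 : ℚ) / 21)) (by norm_num)) : weilNormResidueGroup 1) ≠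
      splitDiscriminantClass 3 1 := by
  have e : Units.mk0 (((-1 : ℚ) / 21)) (by norm_num) = -(Units.mk0 ((1 : ℚ) / 21) (by norm_num)) := Units.ext (by norm_num)
  rw [Ne, e, mk_neg_eq_splitDiscriminantClass_iff_of_odd (n := 3) (by decide)]
  have h := mul_not_mem_normUnitsSubgroup (mem_normUnitsSubgroup_of_sq_add_mul_sq (d := 1) (a := ((1 : ℚ) / 441)) (by norm_num) ((1 : ℚ) / 21) (0 : ℚ) (by norm_num))
    Summit.HodgeConjecture.Ring2WeilNormDescent.twentyOne_not_mem_norm_one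
  rw [mk0_mul_mk0] at h
  norm_num at h
  exact h

/-- The same datum, CELL IDENTIFICATION: `[det H|_B] = [-21]` in `ℚˣ/Nm(ℚ(√-1)ˣ)` — the census ROW KEY of `W6.1.21` (`a·21 = (1 : ℚ) = ((1 : ℚ))² + 1·((0 : ℚ))²`).
research route conditional on HC_CM; not a corollary; Q11.4-sentence-2 already refuted in dim ≥ 3. [cite: vanGeemen1994HodgeAV, Lemma 5.2 (3)] -/
theorem pillow4_C4A21_n21_fceac4_mk_detH_eq_key :
    (QuotientGroup.mk (Units.mk0 (-(((1 : ℚ) / 21))) (neg_ne_zero.2 (by norm_num))) : weilNormResidueGroup 1) =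
      QuotientGroup.mk (Units.mk0 (-(21 : ℚ)) (neg_ne_zero.2 (by norm_num))) :=
  mk_neg_eq_mk_neg_of_mul_mem (by norm_num) (by norm_num)
    (mem_normUnitsSubgroup_of_sq_add_mul_sq _ (1 : ℚ) (0 : ℚ) (by norm_num))

/-- PILLOWCASE datum (B₂ alcove lattice, orbifold `ℙ¹(4,4,2) = E_i/C₄`): the double of the lattice 9-gon `P` with turning sequence `-3,+2,+2,+2,-1,+2,-2,+3,+3` (×45°) and side lengths `2,2,2,2,1,2,1,1,2` is a Belyi map `φ_P : ℙ¹ → ℙ¹` of degree `n = 23` (= number of alcoves of `P`) with passport `(7.4^2.2^3.1^2, 5.4^4.2, 3.2^10)` and monodromy group `S23` (certified lower bound 25852016738884976640000); `Y_P : y⁴ = φ_P(φ_P − 1)` (genus 8) is the normalised fibre product `E ×_{ℙ¹} ℙ¹_{φ_P}` (92 sheets over `ℙ¹`; engine `bigwin.py`, exact) and the HIDDEN FACTOR `B` = the `λ`-part of the Prym `P(Y_P/E)` — an abelian SIXFOLD with `(3,3)` `ℚ(√-1)`-action, WEIL TYPE — has literal `det H|_B = -4/23`, `a = 4/23`, `T(a)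 = [2, 23]`: row `W6.1.23` (NON-split); `r₁ = dim_K H¹(D)_λ = 1`, `r_H = 7`. THEOREM S8 (Prym form of the product-window law, census b04.15 (A): `[a_B] = [n]^{r₁}`, no 2-transitivity needed) predicts `T(a_B) = [2, 23]` from `r₁ = 1`, `n = 23` — CONFIRMED.
research route conditional on HC_CM; not a corollary; Q11.4-sentence-2 already refuted in dim ≥ 3. [cite: vanGeemen1994HodgeAV, (5.4.1)] -/
theorem pillow4_C4S23_n23_f80b61_mk_detH_ne_split :
    (QuotientGroup.mk (Units.mk0 (((-4 : ℚ) / 23)) (by norm_num)) : weilNormResidueGroup 1) ≠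
      splitDiscriminantClass 3 1 := by
  have e : Units.mk0 (((-4 : ℚ) / 23)) (by norm_num) = -(Units.mk0 ((4 : ℚ) / 23) (by norm_num)) := Units.ext (by norm_num)
  rw [Ne, e, mk_neg_eq_splitDiscriminantClass_iff_of_odd (n := 3) (by decide)]
  have h := mul_not_mem_normUnitsSubgroup (mem_normUnitsSubgroup_of_sq_add_mul_sq (d := 1) (a := ((4 : ℚ) / 529)) (by norm_num) ((2 : ℚ) / 23) (0 : ℚ) (by norm_num))
    SqrtNeg1.not_mem_23
  rw [mk0_mul_mk0] at h
  norm_num at h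
  exact h

/-- The same datum, CELL IDENTIFICATION: `[det H|_B] = [-23]` in `ℚˣ/Nm(ℚ(√-1)ˣ)` — the census ROW KEY of `W6.1.23` (`a·23 = (4 : ℚ) = ((2 : ℚ))² + 1·((0 : ℚ))²`).
research route conditional on HC_CM; not a corollary; Q11.4-sentence-2 already refuted in dim ≥ 3. [cite: vanGeemen1994HodgeAV, Lemma 5.2 (3)] -/
theorem pillow4_C4S23_n23_f80b61_mk_detH_eq_key :
    (QuotientGroup.mk (Units.mk0 (-(((4 : ℚ) / 23))) (neg_ne_zero.2 (by norm_num))) : weilNormResidueGroup 1) =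
      QuotientGroup.mk (Units.mk0 (-(23 : ℚ)) (neg_ne_zero.2 (by norm_num))) :=
  mk_neg_eq_mk_neg_of_mul_mem (by norm_num) (by norm_num)
    (mem_normUnitsSubgroup_of_sq_add_mul_sq _ (2 : ℚ) (0 : ℚ) (by norm_num))

/-- PILLOWCASE datum (B₂ alcove lattice, orbifold `ℙ¹(4,4,2) = E_i/C₄`): the double of the lattice 9-gon `P` with turning sequence `-2,-1,+3,-2,+3,+1,+1,+2,+3` (×45°) and side lengths `1,1,6,1,1,6,2,1,1` is a Belyi map `φ_P : ℙ¹ → ℙ¹` of degree `n = 28` (= number of alcoves of `P`) with passport `(4^5.3^2.1^2, 5.4^5.2.1, 3^2.2^11)` and monodromy group `S28` (certified lower bound 304888344611713860501504000000); `Y_P : y⁴ = φ_P(φ_P − 1)` (genus 9) is the normalised fibre product `E ×_{ℙ¹} ℙ¹_{φ_P}` (112 sheets over `ℙ¹`; engine `bigwin.py`, exact) and the HIDDEN FACTOR `B` = the `λ`-part of the Prym `P(Y_P/E)` — an abelian SIXFOLD with `(3,3)` `ℚ(√-1)`-action, WEIL TYPE — has literal `det H|_B = -1/56`, `a = 1/56`,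 `T(a) = [2, 7]`: row `W6.1.7` (NON-split); `r₁ = dim_K H¹(D)_λ = 1`, `r_H = 7`. THEOREM S8 (Prym form of the product-window law, census b04.15 (A): `[a_B] = [n]^{r₁}`, no 2-transitivity needed) predicts `T(a_B) = [2, 7]` from `r₁ = 1`, `n = 28` — CONFIRMED.
research route conditional on HC_CM; not a corollary; Q11.4-sentence-2 already refuted in dim ≥ 3. [cite: vanGeemen1994HodgeAV, (5.4.1)] -/
theorem pillow4_C4S28_n28_bce19e_mk_detH_ne_split :
    (QuotientGroup.mk (Units.mk0 (((-1 : ℚ) / 56)) (by norm_num)) : weilNormResidueGroup 1) ≠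
      splitDiscriminantClass 3 1 := by
  have e : Units.mk0 (((-1 : ℚ) / 56)) (by norm_num) = -(Units.mk0 ((1 : ℚ) / 56) (by norm_num)) := Units.ext (by norm_num)
  rw [Ne, e, mk_neg_eq_splitDiscriminantClass_iff_of_odd (n := 3) (by decide)]
  have h := mul_not_mem_normUnitsSubgroup (mem_normUnitsSubgroup_of_sq_add_mul_sq (d := 1) (a := ((1 : ℚ) / 392)) (by norm_num) ((1 : ℚ) / 28) ((1 : ℚ) / 28) (by norm_num))
    Summit.HodgeConjecture.Ring2WeilNormDescent.seven_not_mem_norm_one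
  rw [mk0_mul_mk0] at h
  norm_num at h
  exact h

/-- The same datum, CELL IDENTIFICATION: `[det H|_B] = [-7]` in `ℚˣ/Nm(ℚ(√-1)ˣ)` — the census ROW KEY of `W6.1.7` (`a·7 = ((1 : ℚ) / 8) = (((1 : ℚ) / 4))² + 1·(((1 : ℚ) / 4))²`).
research route conditional on HC_CM; not a corollary; Q11.4-sentence-2 already refuted in dim ≥ 3. [cite: vanGeemen1994HodgeAV, Lemma 5.2 (3)] -/
theorem pillow4_C4S28_n28_bce19e_mk_detH_eq_key :
    (QuotientGroup.mk (Units.mk0 (-(((1 : ℚ) / 56))) (neg_ne_zero.2 (by norm_num))) : weilNormResidueGroup 1) =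
      QuotientGroup.mk (Units.mk0 (-(7 : ℚ)) (neg_ne_zero.2 (by norm_num))) :=
  mk_neg_eq_mk_neg_of_mul_mem (by norm_num) (by norm_num)
    (mem_normUnitsSubgroup_of_sq_add_mul_sq _ ((1 : ℚ) / 4) ((1 : ℚ) / 4) (by norm_num))

/-- PILLOWCASE datum (B₂ alcove lattice, orbifold `ℙ¹(4,4,2) = E_i/C₄`): the double of the lattice 9-gon `P` with turning sequence `-2,-1,+2,+2,+1,-1,+2,+2,+3` (×45°) and side lengths `1,1,2,2,2,2,1,2,2` is a Belyi map `φ_P : ℙ¹ → ℙ¹` of degree `n = 33` (= number of alcoves of `P`) with passport `(4^7.2^2.1, 5^2.4^4.3.2^2, 3.2^15)` and monodromy group `S33` (certified lower bound 8683317618811886495518194401280000000); `Y_P : y⁴ = φ_P(φ_P − 1)` (genus 8) is the normalised fibre product `E ×_{ℙ¹} ℙ¹_{φ_P}` (132 sheets over `ℙ¹`; engine `bigwin.py`, exact) and the HIDDEN FACTOR `B` = the `λ`-part of the Prym `P(Y_P/E)` — an abelian SIXFOLD with `(3,3)` `ℚ(√-1)`-action, WEIL TYPE — has literal `det H|_B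 = -4/33`, `a = 4/33`, `T(a) = [3, 11]`: row `W6.1.33` (NON-split); `r₁ = dim_K H¹(D)_λ = 1`, `r_H = 7`. THEOREM S8 (Prym form of the product-window law, census b04.15 (A): `[a_B] = [n]^{r₁}`, no 2-transitivity needed) predicts `T(a_B) = [3, 11]` from `r₁ = 1`, `n = 33` — CONFIRMED.
research route conditional on HC_CM; not a corollary; Q11.4-sentence-2 already refuted in dim ≥ 3. [cite: vanGeemen1994HodgeAV, (5.4.1)] -/
theorem pillow4_C4S33_n33_665909_mk_detH_ne_split :
    (QuotientGroup.mk (Units.mk0 (((-4 : ℚ) / 33)) (by norm_num)) : weilNormResidueGroup 1) ≠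
      splitDiscriminantClass 3 1 := by
  have e : Units.mk0 (((-4 : ℚ) / 33)) (by norm_num) = -(Units.mk0 ((4 : ℚ) / 33) (by norm_num)) := Units.ext (by norm_num)
  rw [Ne, e, mk_neg_eq_splitDiscriminantClass_iff_of_odd (n := 3) (by decide)]
  have h := mul_not_mem_normUnitsSubgroup (mem_normUnitsSubgroup_of_sq_add_mul_sq (d := 1) (a := ((4 : ℚ) / 1089)) (by norm_num) ((2 : ℚ) / 33) (0 : ℚ) (by norm_num))
    Summit.HodgeConjecture.HodgeConjecture.Ring2.WeilCoverage.SqrtNeg1.not_mem_33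
  rw [mk0_mul_mk0] at h
  norm_num at h
  exact h

/-- The same datum, CELL IDENTIFICATION: `[det H|_B] = [-33]` in `ℚˣ/Nm(ℚ(√-1)ˣ)` — the census ROW KEY of `W6.1.33` (`a·33 = (4 : ℚ) = ((2 : ℚ))² + 1·((0 : ℚ))²`).
research route conditional on HC_CM; not a corollary; Q11.4-sentence-2 already refuted in dim ≥ 3. [cite: vanGeemen1994HodgeAV, Lemma 5.2 (3)] -/
theorem pillow4_C4S33_n33_665909_mk_detH_eq_key :
    (QuotientGroup.mk (Units.mk0 (-(((4 : ℚ) / 33))) (neg_ne_zero.2 (by norm_num))) : weilNormResidueGroup 1) =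
      QuotientGroup.mk (Units.mk0 (-(33 : ℚ)) (neg_ne_zero.2 (by norm_num))) :=
  mk_neg_eq_mk_neg_of_mul_mem (by norm_num) (by norm_num)
    (mem_normUnitsSubgroup_of_sq_add_mul_sq _ (2 : ℚ) (0 : ℚ) (by norm_num))

/-! ### §2 The first fibre-product data (random realisation, engine `symwin.py`): `W6.3.22`, `W6.1.21`, `W6.1.19` -/

/-- FIBRE-PRODUCT datum `C3xS22` `(0; c1:3^5.2.1^5,c1:5.3^5.2,c1:6^2.3^3.1)` (cycle types in `S22`; Hurwitz dimension 0; realised by explicit permutations with product one, generation: 2-transitive + Jordan (a 2-cycle as the 3-th power of a branch cycle, 2 <= n-3) => monodromy >= A_22): `Y = D ×_{ℙ¹} X` (genus 7; `D` the `C3`-quotient datum = the CM elliptic curve, `X` the degree-22 cover, genus 0), computed on its 66 sheets (engine `bigwin.py`, exact); the HIDDEN FACTOR `B` = the `λ`-part of the Prym `P(Y/D)` — an abelian SIXFOLD with `(3,3)` `ℚ(√-3)`-action, WEIL TYPE — has literal `det H|_B = -32/11`, `a = 32/11`, `T(a) = [2, 11]`: row `W6.3.22` (NON-split); `r₁ =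 dim_K H¹(D)_λ = 1`, `r_H = 7`. THEOREM S8 (Prym form of the product-window law, census b04.15 (A): `[a_B] = [n]^{r₁}`, no 2-transitivity needed) predicts `T(a_B) = [2, 11]` from `r₁ = 1`, `n = 22` — CONFIRMED.
research route conditional on HC_CM; not a corollary; Q11.4-sentence-2 already refuted in dim ≥ 3. [cite: vanGeemen1994HodgeAV, (5.4.1)] -/
theorem fibre_C3S22_n22_5e8a10_mk_detH_ne_split :
    (QuotientGroup.mk (Units.mk0 (((-32 : ℚ) / 11)) (by norm_num)) : weilNormResidueGroup 3) ≠
      splitDiscriminantClass 3 3 := by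
  have e : Units.mk0 (((-32 : ℚ) / 11)) (by norm_num) = -(Units.mk0 ((32 : ℚ) / 11) (by norm_num)) := Units.ext (by norm_num)
  rw [Ne, e, mk_neg_eq_splitDiscriminantClass_iff_of_odd (n := 3) (by decide)]
  have h := mul_not_mem_normUnitsSubgroup (mem_normUnitsSubgroup_of_sq_add_mul_sq (d := 3) (a := ((16 : ℚ) / 121)) (by norm_num) ((4 : ℚ) / 11) (0 : ℚ) (by norm_num))
    Summit.HodgeConjecture.Ring2WeilNormDescent.twentyTwo_not_mem_norm_three
  rw [mk0_mul_mk0] at h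
  norm_num at h
  exact h

/-- The same datum, CELL IDENTIFICATION: `[det H|_B] = [-22]` in `ℚˣ/Nm(ℚ(√-3)ˣ)` — the census ROW KEY of `W6.3.22` (`a·22 = (64 : ℚ) = ((8 : ℚ))² + 3·((0 : ℚ))²`).
research route conditional on HC_CM; not a corollary; Q11.4-sentence-2 already refuted in dim ≥ 3. [cite: vanGeemen1994HodgeAV, Lemma 5.2 (3)] -/
theorem fibre_C3S22_n22_5e8a10_mk_detH_eq_key :
    (QuotientGroup.mk (Units.mk0 (-(((32 : ℚ) / 11))) (neg_ne_zero.2 (by norm_num))) : weilNormResidueGroup 3) =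
      QuotientGroup.mk (Units.mk0 (-(22 : ℚ)) (neg_ne_zero.2 (by norm_num))) :=
  mk_neg_eq_mk_neg_of_mul_mem (by norm_num) (by norm_num)
    (mem_normUnitsSubgroup_of_sq_add_mul_sq _ (8 : ℚ) (0 : ℚ) (by norm_num))

/-- FIBRE-PRODUCT datum `C3xS22` `(0; c1:3^5.2.1^5,c1:5.3^5.2,c1:4.3^6,c0:2.1^20)` (cycle types in `S22`; Hurwitz dimension 1 — a ONE-PARAMETER FAMILY; realised by explicit permutations with product one, generation: 2-transitive + Jordan (a 2-cycle as the 1-th power of a branch cycle, 2 <= n-3) => monodromy >= A_22): `Y = D ×_{ℙ¹} X` (genus 7; `D` the `C3`-quotient datum = the CM elliptic curve, `X` the degree-22 cover, genus 0), computed on its 66 sheets (engine `bigwin.py`, exact); the HIDDEN FACTOR `B` = the `λ`-part of the Prym `P(Y/D)` — an abelian SIXFOLD with `(3,3)` `ℚ(√-3)`-action, WEIL TYPE — has literal `det H|_B = -32/11`, `a = 32/11`, `T(a) = [2, 11]`: row `W6.3.22` (NON-split); `r₁ = dim_K H¹(D)_λ = 1`, `r_H = 7`. THEOREM S8 (Prym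 form of the product-window law, census b04.15 (A): `[a_B] = [n]^{r₁}`, no 2-transitivity needed) predicts `T(a_B) = [2, 11]` from `r₁ = 1`, `n = 22` — CONFIRMED.
research route conditional on HC_CM; not a corollary; Q11.4-sentence-2 already refuted in dim ≥ 3. [cite: vanGeemen1994HodgeAV, (5.4.1)] -/
theorem fibre_C3S22_n22_cc4f57_mk_detH_ne_split :
    (QuotientGroup.mk (Units.mk0 (((-32 : ℚ) / 11)) (by norm_num)) : weilNormResidueGroup 3) ≠
      splitDiscriminantClass 3 3 := by
  have e : Units.mk0 (((-32 : ℚ) / 11)) (by norm_num) = -(Units.mk0 ((32 : ℚ) / 11) (by norm_num)) := Units.ext (by norm_num)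
  rw [Ne, e, mk_neg_eq_splitDiscriminantClass_iff_of_odd (n := 3) (by decide)]
  have h := mul_not_mem_normUnitsSubgroup (mem_normUnitsSubgroup_of_sq_add_mul_sq (d := 3) (a := ((16 : ℚ) / 121)) (by norm_num) ((4 : ℚ) / 11) (0 : ℚ) (by norm_num))
    Summit.HodgeConjecture.Ring2WeilNormDescent.twentyTwo_not_mem_norm_three
  rw [mk0_mul_mk0] at h
  norm_num at h
  exact h

/-- The same datum, CELL IDENTIFICATION: `[det H|_B] = [-22]` in `ℚˣ/Nm(ℚ(√-3)ˣ)` — the census ROW KEY of `W6.3.22` (`a·22 = (64 : ℚ) = ((8 : ℚ))² + 3·((0 : ℚ))²`).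
research route conditional on HC_CM; not a corollary; Q11.4-sentence-2 already refuted in dim ≥ 3. [cite: vanGeemen1994HodgeAV, Lemma 5.2 (3)] -/
theorem fibre_C3S22_n22_cc4f57_mk_detH_eq_key :
    (QuotientGroup.mk (Units.mk0 (-(((32 : ℚ) / 11))) (neg_ne_zero.2 (by norm_num))) : weilNormResidueGroup 3) =
      QuotientGroup.mk (Units.mk0 (-(22 : ℚ)) (neg_ne_zero.2 (by norm_num))) :=
  mk_neg_eq_mk_neg_of_mul_mem (by norm_num) (by norm_num)
    (mem_normUnitsSubgroup_of_sq_add_mul_sq _ (8 : ℚ) (0 : ℚ) (by norm_num))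

/-- FIBRE-PRODUCT datum `C4xA21` `(0; c1:15.3^2,c1:4^4.1^5,c2:2^10.1)` (cycle types in `A21`; Hurwitz dimension 0; realised by explicit permutations with product one, generation: randomized Schreier-Sims lower bound = 21!/2): `Y = D ×_{ℙ¹} X` (genus 10; `D` the `C4`-quotient datum = the CM elliptic curve, `X` the degree-21 cover, genus 0), computed on its 84 sheets (engine `bigwin.py`, exact); the HIDDEN FACTOR `B` = the `λ`-part of the Prym `P(Y/D)` — an abelian SIXFOLD with `(3,3)` `ℚ(√-1)`-action, WEIL TYPE — has literal `det H|_B = -2/21`, `a = 2/21`, `T(a) = [3, 7]`: row `W6.1.21` (NON-split); `r₁ = dim_K H¹(D)_λ = 1`, `r_H = 7`. THEOREM S8 (Prym form of the product-window law, census b04.15 (A): `[a_B] = [n]^{r₁}`, no 2-transitivity needed) predicts `T(a_B) = [3, 7]` from `r₁ = 1`, `n = 21` — CONFIRMED.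
research route conditional on HC_CM; not a corollary; Q11.4-sentence-2 already refuted in dim ≥ 3. [cite: vanGeemen1994HodgeAV, (5.4.1)] -/
theorem fibre_C4A21_n21_53b7a6_mk_detH_ne_split :
    (QuotientGroup.mk (Units.mk0 (((-2 : ℚ) / 21)) (by norm_num)) : weilNormResidueGroup 1) ≠
      splitDiscriminantClass 3 1 := by
  have e : Units.mk0 (((-2 : ℚ) / 21)) (by norm_num) = -(Units.mk0 ((2 : ℚ) / 21) (by norm_num)) := Units.ext (by norm_num)
  rw [Ne, e, mk_neg_eq_splitDiscriminantClass_iff_of_odd (n := 3) (by decide)]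
  have h := mul_not_mem_normUnitsSubgroup (mem_normUnitsSubgroup_of_sq_add_mul_sq (d := 1) (a := ((2 : ℚ) / 441)) (by norm_num) ((1 : ℚ) / 21) ((1 : ℚ) / 21) (by norm_num))
    Summit.HodgeConjecture.Ring2WeilNormDescent.twentyOne_not_mem_norm_one
  rw [mk0_mul_mk0] at h
  norm_num at h
  exact h

/-- The same datum, CELL IDENTIFICATION: `[det H|_B] = [-21]` in `ℚˣ/Nm(ℚ(√-1)ˣ)` — the census ROW KEY of `W6.1.21` (`a·21 = (2 : ℚ) = ((1 : ℚ))² + 1·((1 : ℚ))²`).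
research route conditional on HC_CM; not a corollary; Q11.4-sentence-2 already refuted in dim ≥ 3. [cite: vanGeemen1994HodgeAV, Lemma 5.2 (3)] -/
theorem fibre_C4A21_n21_53b7a6_mk_detH_eq_key :
    (QuotientGroup.mk (Units.mk0 (-(((2 : ℚ) / 21))) (neg_ne_zero.2 (by norm_num))) : weilNormResidueGroup 1) =
      QuotientGroup.mk (Units.mk0 (-(21 : ℚ)) (neg_ne_zero.2 (by norm_num))) :=
  mk_neg_eq_mk_neg_of_mul_mem (by norm_num) (by norm_num)
    (mem_normUnitsSubgroup_of_sq_add_mul_sq _ (1 : ℚ) (1 : ℚ) (by norm_num))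

/-- FIBRE-PRODUCT datum `C4xS19` `(0; c1:18.1,c1:4^4.2.1,c2:2^9.1,c0:2.1^17)` (cycle types in `S19`; Hurwitz dimension 1 — a ONE-PARAMETER FAMILY; realised by explicit permutations with product one, generation: 2-transitive + Jordan (a 2-cycle as the 1-th power of a branch cycle, 2 <= n-3) => monodromy >= A_19): `Y = D ×_{ℙ¹} X` (genus 11; `D` the `C4`-quotient datum = the CM elliptic curve, `X` the degree-19 cover, genus 2), computed on its 76 sheets (engine `bigwin.py`, exact); the HIDDEN FACTOR `B` = the `λ`-part of the Prym `P(Y/D)` — an abelian SIXFOLD with `(3,3)` `ℚ(√-1)`-action, WEIL TYPE — has literal `det H|_B = -1/19`, `a = 1/19`, `T(a) = [2, 19]`: row `W6.1.19` (NON-split); `r₁ = dim_K H¹(D)_λ = 1`, `r_H = 7`. THEOREM S8 (Prym form of the product-window law, census b04.15 (A): `[a_B] = [n]^{r₁}`, no 2-transitivity needed) predicts `T(a_B) = [2, 19]` from `r₁ = 1`, `n = 19` — CONFIRMED.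
research route conditional on HC_CM; not a corollary; Q11.4-sentence-2 already refuted in dim ≥ 3. [cite: vanGeemen1994HodgeAV, (5.4.1)] -/
theorem fibre_C4S19_n19_21da78_mk_detH_ne_split :
    (QuotientGroup.mk (Units.mk0 (((-1 : ℚ) / 19)) (by norm_num)) : weilNormResidueGroup 1) ≠
      splitDiscriminantClass 3 1 := by
  have e : Units.mk0 (((-1 : ℚ) / 19)) (by norm_num) = -(Units.mk0 ((1 : ℚ) / 19) (by norm_num)) := Units.ext (by norm_num)
  rw [Ne, e, mk_neg_eq_splitDiscriminantClass_iff_of_odd (n := 3) (by decide)]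
  have h := mul_not_mem_normUnitsSubgroup (mem_normUnitsSubgroup_of_sq_add_mul_sq (d := 1) (a := ((1 : ℚ) / 361)) (by norm_num) ((1 : ℚ) / 19) (0 : ℚ) (by norm_num))
    Summit.HodgeConjecture.HodgeConjecture.Ring2.WeilCoverage.SqrtNeg1.not_mem_19
  rw [mk0_mul_mk0] at h
  norm_num at h
  exact h

/-- The same datum, CELL IDENTIFICATION: `[det H|_B] = [-19]` in `ℚˣ/Nm(ℚ(√-1)ˣ)` — the census ROW KEY of `W6.1.19` (`a·19 = (1 : ℚ) = ((1 : ℚ))² + 1·((0 : ℚ))²`).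
research route conditional on HC_CM; not a corollary; Q11.4-sentence-2 already refuted in dim ≥ 3. [cite: vanGeemen1994HodgeAV, Lemma 5.2 (3)] -/
theorem fibre_C4S19_n19_21da78_mk_detH_eq_key :
    (QuotientGroup.mk (Units.mk0 (-(((1 : ℚ) / 19))) (neg_ne_zero.2 (by norm_num))) : weilNormResidueGroup 1) =
      QuotientGroup.mk (Units.mk0 (-(19 : ℚ)) (neg_ne_zero.2 (by norm_num))) :=
  mk_neg_eq_mk_neg_of_mul_mem (by norm_num) (by norm_num)
    (mem_normUnitsSubgroup_of_sq_add_mul_sq _ (1 : ℚ) (0 : ℚ) (by norm_num))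

end Summit.HodgeConjecture.HodgeConjecture.Ring2.WeilCoverage
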